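import Literature.Probability.RandomPlanarGeometry.SLERSObservableIto
import Literature.Probability.RandomPlanarGeometry.SLEKappaRhoSchrammObservable
import HarnessLib

/-!
# Schramm's martingale for SLE_{8/3}: `(1 + cos arg(g_t(z) − W_t))/2` stopped before swallowing is a martingale

Topic `Probability/RandomPlanarGeometry`; theorems only (plus the calculus of Schramm's function).
This file discharges the "martingale" input of the conditional assembly of
`SLEKappaRhoSchrammObservable` (`SLEKappaRho.measure_I_notMem_fill_lt_of_neg_of_schramm`, [LSW]
proof of Cor. 8.6, p. 38, in Schramm's coordinates), after

* O. Schramm, *A percolation formula*, Electron. Comm. Probab. **6** (2001) 115–120,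
  arXiv:math/0107096, proof of Thm. 2: with `x_t = Re g_t(z₀) − W(t)`, `y_t = Im g_t(z₀)`,
  `w_t = x_t/y_t`, "`dw_t = −dW(t)/y_t + 4 w_t dt/(x_t² + y_t²)` … `h(w_u)` is a local martingale.
  Therefore … `h` satisfies `(κ/2) h''(w) + (4w/(w² + 1)) h'(w) = 0` … Itô's formula implies that
  the right hand side in (3) is a martingale", and Thm. 2 for `κ = 8/3`: the left-passage
  probability is `½ + x₀/(2|z₀|)`, i.e. `h(w) = (1 + w/√(1 + w²))/2` (`schrammH`);
* S. Rohde, O. Schramm, *Basic properties of SLE*, Ann. of Math. **161** (2005), proof of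
  Lemma 6.3, p. 905 (localization: "there is an increasing sequence of stopping times `tₙ < τ(ẑ)`
  with `limₙ tₙ = τ(ẑ)` a.s. such that `M_{t∧tₙ}` is a martingale").

Main result: `martingale_schrammObsStopped_sle` — for the SLE_{8/3} driving function
`W = √(8/3) B` on the canonical space, `z ∈ ℍ` and every `n`, Schramm's observable
`S_t = (1 + Re z_t/|z_t|)/2 = h(w_t)` stopped at the localizing time `ρₙ`
(`schrammObsStopped (fun s ω ↦ sleDriving (8/3) ω s) z n`, `Loewner.locTime` = `slePointLocTime`)
is a martingale for the raw Brownian filtration under the pre-Wiener measure. The proof is the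
tree's Itô step for Rohde–Schramm's observable (`SLERSObservableIto`,
`martingale_stoppedProcess_sleRSObservable_of_le_locTime`) with `ψ^a` replaced by `1` and the
hypergeometric `Ĝ` by the elementary odd solution `h`: `x^{ρₙ}` is an Itô process
(`isItoProcess_stoppedProcess_slePointRe`), `w = x · (1/y)` by the product rule
(`IsItoProcess.mul_timeIntegral`), `h(w)` by Itô's formula (`ito_formula_itoProcess_ae_holds`),
the drift `(1/y²)[(κ/2) h'' + (4w/(1 + w²)) h'](w)` vanishes by Schramm's equation at
`κ = 8/3` (`schrammH_ode`, read through `rsObservable_itoDrift_eq_zero` with `a = 0`), and the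
Itô integrand `−√κ h'(w)/y` is bounded on `[0, ρₙ]` (`|h'| ≤ 1/2`, `y ≥ Im z/(n+2)`; no bound on
the slope is needed, unlike for `Ĝ`), so that `h(w) = h(Re z/Im z) + ∫ … dB` is a martingale.
Also proved: `h' = 1/(2(1 + w²)^{3/2})`, `h'' = −3w/(2(1 + w²)^{5/2})`, `h ∈ C^∞`.

## References

* O. Schramm, *A percolation formula*, Electron. Comm. Probab. 6 (2001), Thm. 2 and its proof.
* S. Rohde, O. Schramm, *Basic properties of SLE*, Ann. of Math. 161 (2005), proof of Lemma 6.3.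
* D. Revuz, M. Yor, *Continuous Martingales and Brownian Motion* (1999), Ch. IV, Thm (3.3).
-/

noncomputable section

open Set Filter MeasureTheory Complex
open _root_.Topology
open scoped NNReal ENNReal

namespace Literature.Probability.RandomPlanarGeometry

open Loewner Literature.Probability.Process Literature.Analysis.FunctionSpaces

/-! ### Calculus of Schramm's function `h(w) = (1 + w/√(1 + w²))/2` -/

section Calculus

/-- `1 ≤ √(1 + w²)`. [folklore] -/
theorem one_le_sqrt_one_add_sq (w : ℝ) : 1 ≤ Real.sqrt (1 + w ^ 2) :=
  calc (1 : ℝ) = Real.sqrt 1 := Real.sqrt_one.symm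
    _ ≤ Real.sqrt (1 + w ^ 2) := Real.sqrt_le_sqrt (by nlinarith)

/-- `(√(1 + w²))² = 1 + w²`. [folklore] -/
theorem sqrt_one_add_sq_sq (w : ℝ) : Real.sqrt (1 + w ^ 2) ^ 2 = 1 + w ^ 2 :=
  Real.sq_sqrt (by positivity)

/-- `d/dw √(1 + w²) = w/√(1 + w²)`. [folklore] -/
theorem hasDerivAt_sqrt_one_add_sq (w : ℝ) :
    HasDerivAt (fun v : ℝ ↦ Real.sqrt (1 + v ^ 2)) (w / Real.sqrt (1 + w ^ 2)) w := by
  have h1 : HasDerivAt (fun v : ℝ ↦ 1 + v ^ 2) (2 * w) w := by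
    simpa using (hasDerivAt_pow 2 w).const_add 1
  have h2 := h1.sqrt (by positivity : (1 + w ^ 2) ≠ 0)
  convert h2 using 1
  field_simp

/-- **`h'(w) = 1/(2 (1 + w²)^{3/2})`** (Schramm's `f' ∝ (1 + w²)^{−4/κ}` at `κ = 8/3`).
[cite: Schramm2001Percolation, Thm. 2 (proof)] -/
theorem hasDerivAt_schrammH (w : ℝ) :
    HasDerivAt schrammH (1 / (2 * Real.sqrt (1 + w ^ 2) ^ 3)) w := by
  have hr : 0 < Real.sqrt (1 + w ^ 2) := Real.sqrt_pos.2 (by positivity)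
  have hq : HasDerivAt (fun v : ℝ ↦ v / Real.sqrt (1 + v ^ 2))
      ((1 * Real.sqrt (1 + w ^ 2) - w * (w / Real.sqrt (1 + w ^ 2))) / Real.sqrt (1 + w ^ 2) ^ 2) w :=
    (hasDerivAt_id w).div (hasDerivAt_sqrt_one_add_sq w) hr.ne'
  have h2 : HasDerivAt schrammH
      (((1 * Real.sqrt (1 + w ^ 2) - w * (w / Real.sqrt (1 + w ^ 2))) / Real.sqrt (1 + w ^ 2) ^ 2) / 2) w := by
    unfold schrammH
    exact (hq.const_add 1).div_const 2
  convert h2 using 1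
  have hsq := sqrt_one_add_sq_sq w
  field_simp
  nlinarith [hsq]

/-- `deriv h = 1/(2 (1 + w²)^{3/2})`. [cite: Schramm2001Percolation, Thm. 2 (proof)] -/
theorem deriv_schrammH : deriv schrammH = fun w ↦ 1 / (2 * Real.sqrt (1 + w ^ 2) ^ 3) :=
  funext fun w ↦ (hasDerivAt_schrammH w).deriv

/-- **`h''(w) = −3w/(2 (1 + w²)^{5/2})`.** [cite: Schramm2001Percolation, Thm. 2 (proof)] -/
theorem hasDerivAt_deriv_schrammH (w : ℝ) :
    HasDerivAt (deriv schrammH) (-(3 * w) / (2 * Real.sqrt (1 + w ^ 2) ^ 5)) w := by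
  rw [deriv_schrammH]
  have hr : 0 < Real.sqrt (1 + w ^ 2) := Real.sqrt_pos.2 (by positivity)
  have h1 : HasDerivAt (fun v : ℝ ↦ 2 * Real.sqrt (1 + v ^ 2) ^ 3)
      (2 * (3 * Real.sqrt (1 + w ^ 2) ^ 2 * (w / Real.sqrt (1 + w ^ 2)))) w :=
    ((hasDerivAt_sqrt_one_add_sq w).pow 3).const_mul 2
  have h3 : HasDerivAt (fun v : ℝ ↦ 1 / (2 * Real.sqrt (1 + v ^ 2) ^ 3))
      ((0 * (2 * Real.sqrt (1 + w ^ 2) ^ 3) -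
        1 * (2 * (3 * Real.sqrt (1 + w ^ 2) ^ 2 * (w / Real.sqrt (1 + w ^ 2))))) /
        (2 * Real.sqrt (1 + w ^ 2) ^ 3) ^ 2) w :=
    (hasDerivAt_const w (1 : ℝ)).div h1 (by positivity)
  convert h3 using 1
  field_simp
  ring

/-- `iteratedDeriv 2 h w = −3w/(2 (1 + w²)^{5/2})`. [cite: Schramm2001Percolation, Thm. 2 (proof)] -/
theorem iteratedDeriv_two_schrammH (w : ℝ) :
    iteratedDeriv 2 schrammH w = -(3 * w) / (2 * Real.sqrt (1 + w ^ 2) ^ 5) := by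
  rw [iteratedDeriv_succ, iteratedDeriv_one]
  exact (hasDerivAt_deriv_schrammH w).deriv

/-- `h` is `C²` (indeed smooth: `1 + w² > 0`). [folklore] -/
theorem contDiff_schrammH {n : WithTop ℕ∞} : ContDiff ℝ n schrammH := by
  unfold schrammH
  refine (contDiff_const.add (contDiff_id.div ?_ fun w ↦ (Real.sqrt_pos.2 (by positivity)).ne')).div_const _
  exact (contDiff_const.add (contDiff_id.pow 2)).sqrt fun w ↦ by positivity

/-- **Schramm's equation at `κ = 8/3`**: `(κ/2) h'' + (4w/(w² + 1)) h' = 0` for `h = schrammH`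
(Schramm (2001), proof of Thm. 2: "`h` satisfies `(κ/2) h''(w) + (4w/(w² + 1)) h'(w) = 0`"),
written with a vanishing zeroth-order term so as to match `rsObservable_itoDrift_eq_zero` (`a = 0`).
[cite: Schramm2001Percolation, Thm. 2 (proof)] -/
theorem schrammH_ode (w : ℝ) :
    ((8 / 3 : ℝ≥0) : ℝ) / 2 * iteratedDeriv 2 schrammH w + 4 * w / (1 + w ^ 2) * deriv schrammH w +
      4 * 0 / (1 + w ^ 2) ^ 2 * schrammH w = 0 := by
  rw [iteratedDeriv_two_schrammH, (hasDerivAt_schrammH w).deriv, schrammH]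
  obtain ⟨r, hr, hr2⟩ : ∃ r : ℝ, 0 < r ∧ r ^ 2 = 1 + w ^ 2 :=
    ⟨Real.sqrt (1 + w ^ 2), Real.sqrt_pos.2 (by positivity), sqrt_one_add_sq_sq w⟩
  rw [← hr2, Real.sqrt_sq hr.le]
  push_cast
  field_simp
  ring

/-- `|h'(w)| ≤ 1/2`. [folklore] -/
theorem abs_deriv_schrammH_le (w : ℝ) : |deriv schrammH w| ≤ 1 / 2 := by
  rw [deriv_schrammH]
  have hr := one_le_sqrt_one_add_sq w
  have hr3 : 1 ≤ Real.sqrt (1 + w ^ 2) ^ 3 := one_le_pow₀ hr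
  rw [abs_of_pos (by positivity)]
  rw [div_le_div_iff₀ (by positivity) two_pos]
  linarith

end Calculus

/-! ### Schramm's martingale -/

section Main

variable {z : ℂ}

/-- **Schramm's martingale for SLE_{8/3}, localized** (Schramm (2001), proof of Thm. 2: "Note that
`h(w_u)` is a local martingale … Itô's formula implies that the right hand side in (3) is a
martingale"; localization as in Rohde–Schramm (2005), proof of Lemma 6.3, p. 905: "there is an
increasing sequence of stopping times `tₙ < τ(ẑ)` … such that `M_{t∧tₙ}` is a martingale"):
for the SLE_{8/3} driving function `W = √(8/3) B` on the canonical space, `z ∈ ℍ` and every `n`,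
Schramm's observable `S_t = (1 + Re z_t/|z_t|)/2 = h(w_t)` of the chain driven by `W`, stopped
at the localizing time `ρₙ` (`schrammObsStopped`), is a martingale for the raw Brownian
filtration under the pre-Wiener measure. Proof: with the stopped flow `x = x^{ρₙ}`, `y = y^{ρₙ}`
of `SLEPointFlowStopped`, `x` is an Itô process `dx = 𝟙(2x/|z|²) dt + 𝟙(−√κ) dB`
(`isItoProcess_stoppedProcess_slePointRe`), `1/y = 1/y₀ + ∫ 𝟙 2/(y|z|²)` is of finite variation,
so `w = x/y` is an Itô process by the product rule (`IsItoProcess.mul_timeIntegral`) and `h(w)`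
by Itô's formula (`ito_formula_itoProcess_ae`); its drift
`(1/y²)[(κ/2) h'' + (4w/(1 + w²)) h'](w)` vanishes by Schramm's equation at `κ = 8/3`
(`schrammH_ode`, through `rsObservable_itoDrift_eq_zero` with `a = 0`), and the Itô integrand
`−√κ h'(w)/y` is bounded on `[0, ρₙ]` (`|h'| ≤ 1/2`, `y ≥ Im z/(n+2)`), so `h(w) = h(w₀) + ∫ … dB` is
a genuine martingale. [cite: Schramm2001Percolation, Thm. 2 (proof); RohdeSchramm2005, Lemma 6.3 (proof, p. 905)] -/
theorem martingale_schrammObsStopped_sle (hz : 0 < z.im) (n : ℕ) :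
    Martingale (schrammObsStopped (fun s ω ↦ sleDriving (8 / 3) ω s) z n) brownianFiltration
      preWienerMeasure := by
  haveI := isProbabilityMeasure_preWienerMeasure'
  set κ : ℝ≥0 := 8 / 3 with hκdef
  have hκ : 0 < κ := by rw [hκdef]; positivity
  have hκ0 : (0 : ℝ) < κ := by exact_mod_cast hκ
  set σ : (ℝ≥0 → ℝ) → WithTop ℝ≥0 := slePointLocTime κ z n with hσdef
  have hσ : IsStoppingTime brownianFiltration σ := isStoppingTime_slePointLocTime κ hz n
  have hσρ : ∀ ω, σ ω ≤ slePointLocTime κ z n ω := fun ω ↦ le_rfl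
  have hσ' : ∀ t : ℝ≥0, MeasurableSet[brownianFiltration t] {ω | σ ω < t} :=
    fun t ↦ hσ.measurableSet_lt t
  -- the processes
  set X : ℝ≥0 → (ℝ≥0 → ℝ) → ℝ := stoppedProcess (slePointRe κ z) σ with hXdef
  set Y : ℝ≥0 → (ℝ≥0 → ℝ) → ℝ := stoppedProcess (slePointIm κ z) σ with hYdef
  set A : ℝ≥0 → (ℝ≥0 → ℝ) → ℝ := fun t ω ↦ (Y t ω)⁻¹ with hAdef
  set w : ℝ≥0 → (ℝ≥0 → ℝ) → ℝ := fun t ω ↦ X t ω * A t ω with hwdef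
  set h : ℝ → ℝ := schrammH with hhdef
  set σB : ℝ≥0 → (ℝ≥0 → ℝ) → ℝ := trunc σ (fun _ _ ↦ -Real.sqrt κ) with hσBdef
  set bX : ℝ≥0 → (ℝ≥0 → ℝ) → ℝ := trunc σ (fun s ω ↦ loewnerReDrift (X s ω) (Y s ω)) with hbXdef
  set aA : ℝ≥0 → (ℝ≥0 → ℝ) → ℝ := trunc σ (fun s ω ↦ loewnerInvImDrift (X s ω) (Y s ω)) with haAdef
  set bw : ℝ≥0 → (ℝ≥0 → ℝ) → ℝ := fun t ω ↦ X t ω * aA t ω + A t ω * bX t ω with hbwdef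
  set σw : ℝ≥0 → (ℝ≥0 → ℝ) → ℝ := fun t ω ↦ σB t ω * A t ω with hσwdef
  set D1 : ℝ≥0 → (ℝ≥0 → ℝ) → ℝ := fun t ω ↦
    bw t ω * deriv h (w t ω) + 2⁻¹ * σw t ω ^ 2 * iteratedDeriv 2 h (w t ω) with hD1def
  set σG : ℝ≥0 → (ℝ≥0 → ℝ) → ℝ := fun t ω ↦ σw t ω * deriv h (w t ω) with hσGdef
  -- pathwise values and bounds
  have hYpos : ∀ t ω, 0 < Y t ω := fun t ω ↦ stoppedProcess_slePointIm_pos hz hσρ t ω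
  have hYlev : ∀ t ω, z.im / (n + 2) ≤ Y t ω := fun t ω ↦ level_le_stoppedProcess_slePointIm hz hσρ t ω
  have hYle : ∀ t ω, Y t ω ≤ z.im := fun t ω ↦ stoppedProcess_slePointIm_le hz hσρ t ω
  have hwcot : ∀ t ω, w t ω = cotArg (sleDriving κ ω) z ((min (t : WithTop ℝ≥0) (σ ω)).untopA) :=
    fun t ω ↦ by rw [← stopped_div_eq_cotArg hz hσρ t ω, div_eq_mul_inv]
  have hAbd : ∀ t ω, |A t ω| ≤ (n + 2) / z.im := fun t ω ↦ by
    simp only [hAdef]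
    rw [abs_of_pos (inv_pos.2 (hYpos t ω)), inv_eq_one_div, div_le_div_iff₀ (hYpos t ω) hz, one_mul]
    have := hYlev t ω
    rw [div_le_iff₀ (by positivity : (0 : ℝ) < n + 2)] at this
    linarith
  have hσBbd : ∀ t ω, |σB t ω| ≤ Real.sqrt κ := fun t ω ↦ by
    simp only [hσBdef, trunc_apply]
    split_ifs
    · rw [abs_neg, abs_of_nonneg (Real.sqrt_nonneg _)]
    · rw [abs_zero]; exact Real.sqrt_nonneg _
  -- derivatives of `h`
  have hcont : ContDiff ℝ 2 h := contDiff_schrammH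
  have hc0 : Continuous h := hcont.continuous
  have hc1 : Continuous (deriv h) := hcont.continuous_deriv (by norm_num)
  have hC1 : ∀ v, |deriv h v| ≤ 1 / 2 := abs_deriv_schrammH_le
  -- path regularity
  have hXc : ∀ ω, Continuous (X · ω) := fun ω ↦ continuous_stoppedProcess_slePointRe hz hσρ ω
  have hYc : ∀ ω, Continuous (Y · ω) := fun ω ↦ continuous_stoppedProcess_slePointIm hz σ ω
  have hAc : ∀ ω, Continuous (A · ω) := fun ω ↦ (hYc ω).inv₀ fun t ↦ (hYpos t ω).ne'
  have hwc : ∀ ω, Continuous (w · ω) := fun ω ↦ (hXc ω).mul (hAc ω)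
  have hGc : ∀ ω, Continuous (fun t ↦ h (w t ω)) := fun ω ↦ hc0.comp (hwc ω)
  -- adaptedness and progressive measurability
  have hXa : StronglyAdapted brownianFiltration X := stronglyAdapted_stoppedProcess_slePointRe hz hσ
  have hYa : StronglyAdapted brownianFiltration Y := stronglyAdapted_stoppedProcess_slePointIm hz hσ
  have hAa : StronglyAdapted brownianFiltration A := fun t ↦ (hYa t).measurable.inv.stronglyMeasurable
  have hwa : StronglyAdapted brownianFiltration w := fun t ↦ (hXa t).mul (hAa t)
  have hGa : StronglyAdapted brownianFiltration fun t ω ↦ h (w t ω) := fun t ↦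
    hc0.comp_stronglyMeasurable (hwa t)
  have hXp : IsStronglyProgressive brownianFiltration X := hXa.isStronglyProgressive_of_continuous hXc
  have hYp : IsStronglyProgressive brownianFiltration Y := hYa.isStronglyProgressive_of_continuous hYc
  have hAp : IsStronglyProgressive brownianFiltration A := hAa.isStronglyProgressive_of_continuous hAc
  have hwp : IsStronglyProgressive brownianFiltration w := hXp.mul hAp
  have hG1p : IsStronglyProgressive brownianFiltration fun t ω ↦ deriv h (w t ω) :=
    IsStronglyProgressive.continuous_comp hwp hc1
  have hσBp : IsStronglyProgressive brownianFiltration σB :=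
    isStronglyProgressive_trunc (isStronglyProgressive_const _ _) hσ'
  have hσwp : IsStronglyProgressive brownianFiltration σw := hσBp.mul hAp
  have hσGp : IsStronglyProgressive brownianFiltration σG := hσwp.mul hG1p
  have hσwbd : ∀ t ω, |σw t ω| ≤ Real.sqrt κ * ((n + 2) / z.im) := fun t ω ↦ by
    simp only [hσwdef]; rw [abs_mul]
    exact mul_le_mul (hσBbd t ω) (hAbd t ω) (abs_nonneg _) (Real.sqrt_nonneg _)
  have hσGbd : ∀ t ω, |σG t ω| ≤ Real.sqrt κ * ((n + 2) / z.im) * (1 / 2) := fun t ω ↦ by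
    simp only [hσGdef]; rw [abs_mul]
    exact mul_le_mul (hσwbd t ω) (hC1 _) (abs_nonneg _) (by positivity)
  ---------------------------------------------------------------------------
  -- Step 1: `x^σ` is an Itô process
  have hX : IsItoProcess X bX σB brownian brownianFiltration preWienerMeasure :=
    isItoProcess_stoppedProcess_slePointRe hz hσ hσρ
  ---------------------------------------------------------------------------
  -- Step 2: `w = x · (1/y)` is an Itô process (product rule)
  have hXbd' : ∀ t ω, |X t ω| ≤ |z.re| + (n + 2) / z.im * ((n : ℝ) + 1) + ((n : ℝ) + 1) := by
    intro t ω
    set u : ℝ≥0 := (min (t : WithTop ℝ≥0) (σ ω)).untopA with hu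
    have huloc : (u : WithTop ℝ≥0) ≤ slePointLocTime κ z n ω := coe_untopA_min_le_locTime hσρ t ω
    have hun : (u : ℝ) ≤ n + 1 := by exact_mod_cast untopA_min_le_nat_add_one hσρ t ω
    have hW : |Real.sqrt κ * brownian u ω| ≤ n + 1 := by
      rw [← sleDriving_apply]; exact abs_sleDriving_le_of_le_locTime huloc
    -- the drift integral
    have hF : ∀ r : ℝ, |loewnerReDrift (X r.toNNReal ω) (Y r.toNNReal ω)| ≤ (n + 2) / z.im := by
      intro r
      have hy := hYpos r.toNNReal ω
      have h1 : |loewnerReDrift (X r.toNNReal ω) (Y r.toNNReal ω)| ≤ (Y r.toNNReal ω)⁻¹ := by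
        have hQ : 0 < X r.toNNReal ω ^ 2 + Y r.toNNReal ω ^ 2 :=
          add_pos_of_nonneg_of_pos (sq_nonneg _) (pow_pos hy 2)
        rw [loewnerReDrift_apply, abs_div, abs_of_pos hQ, div_le_iff₀ hQ, abs_mul, abs_two,
          inv_mul_eq_div, le_div_iff₀ hy]
        nlinarith [sq_nonneg (|X r.toNNReal ω| - Y r.toNNReal ω), sq_abs (X r.toNNReal ω),
          abs_nonneg (X r.toNNReal ω)]
      refine h1.trans ?_
      rw [inv_eq_one_div, div_le_div_iff₀ hy hz, one_mul]
      have := hYlev r.toNNReal ω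
      rw [div_le_iff₀ (by positivity : (0 : ℝ) < n + 2)] at this
      linarith
    have hI : |timeIntegral bX t ω| ≤ (n + 2) / z.im * ((n : ℝ) + 1) := by
      simp only [hbXdef]
      rw [timeIntegral_trunc]
      simp only [timeIntegral, ← hu]
      have h1 := intervalIntegral.norm_integral_le_of_norm_le_const (a := (0 : ℝ)) (b := (u : ℝ))
        (f := fun r : ℝ ↦ loewnerReDrift (X r.toNNReal ω) (Y r.toNNReal ω)) (C := (n + 2) / z.im)
        fun r _ ↦ by rw [Real.norm_eq_abs]; exact hF r
      rw [Real.norm_eq_abs, sub_zero, abs_of_nonneg (NNReal.coe_nonneg u)] at h1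
      exact h1.trans (mul_le_mul_of_nonneg_left hun (by positivity))
    have hXeq := stoppedProcess_slePointRe_eq_integral hz hσρ t ω
    rw [← hu] at hXeq
    change X t ω = z.re + timeIntegral bX t ω + -Real.sqrt κ * brownian u ω at hXeq
    rw [hXeq]
    have h2 : |(-Real.sqrt κ) * brownian u ω| ≤ n + 1 := by rw [neg_mul, abs_neg]; exact hW
    calc |z.re + timeIntegral bX t ω + -Real.sqrt κ * brownian u ω|
        ≤ |z.re + timeIntegral bX t ω| + |(-Real.sqrt κ) * brownian u ω| := abs_add_le _ _
      _ ≤ (|z.re| + |timeIntegral bX t ω|) + |(-Real.sqrt κ) * brownian u ω| := by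
          gcongr; exact abs_add_le _ _
      _ ≤ |z.re| + (n + 2) / z.im * ((n : ℝ) + 1) + ((n : ℝ) + 1) := by linarith
  obtain ⟨KX, hKX, hKXM⟩ := exists_isItoIntegral_of_abs_le (hσBp.mul hXp)
    (C := Real.sqrt κ * (|z.re| + (n + 2) / z.im * ((n : ℝ) + 1) + ((n : ℝ) + 1))) fun t ω ↦ by
      rw [abs_mul]; exact mul_le_mul (hσBbd t ω) (hXbd' t ω) (abs_nonneg _) (Real.sqrt_nonneg _)
  obtain ⟨K, hK, hKM⟩ := exists_isItoIntegral_of_abs_le (hσBp.mul hAp)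
    (C := Real.sqrt κ * ((n + 2) / z.im)) fun t ω ↦ by
      rw [abs_mul]; exact mul_le_mul (hσBbd t ω) (hAbd t ω) (abs_nonneg _) (Real.sqrt_nonneg _)
  have hA0 : ∀ ω, A 0 ω = (z.im)⁻¹ := fun ω ↦ by
    simp only [hAdef, hYdef]; rw [stoppedProcess_slePointIm_zero hz]
  have hAeq : ∀ᵐ ω ∂preWienerMeasure, ∀ t : ℝ≥0, A t ω = A 0 ω + ∫ s in (0 : ℝ)..t, aA s.toNNReal ω :=
    ae_of_all _ fun ω t ↦ by
      rw [hA0]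
      exact inv_stoppedProcess_slePointIm_eq_integral hz hσρ t ω
  have haA : ∀ᵐ ω ∂preWienerMeasure, ∀ t : ℝ≥0,
      IntegrableOn (fun s : ℝ ↦ aA s.toNNReal ω) (Icc 0 t) :=
    ae_of_all _ fun ω t ↦ integrableOn_trunc_loewnerInvImDrift hz hσρ ω _ isCompact_Icc
  have hw : IsItoProcess w bw σw brownian brownianFiltration preWienerMeasure :=
    IsItoProcess.mul_timeIntegral hXa hXc hσBp hX hAa hAc hAeq haA hKX hKXM hK hKM
  ---------------------------------------------------------------------------
  -- Step 3: `h(w)` is an Itô process (Itô's formula); its drift vanishes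
  obtain ⟨Kw, hKw, hKwM⟩ := exists_isItoIntegral_of_abs_le hσGp hσGbd
  have hf' : ContDiff ℝ 2 (Function.uncurry fun (_ : ℝ) (v : ℝ) ↦ h v) := hcont.comp contDiff_snd
  have hito := ito_formula_itoProcess_ae_holds (fun (_ : ℝ) (v : ℝ) ↦ h v) hf'
    (fun t ↦ (hwa t).measurable) hσwp hw (K := Kw) (by exact hKw)
  have hdrift : ∀ s ω, D1 s ω = 0 := by
    intro s ω
    by_cases hs : (s : WithTop ℝ≥0) ≤ σ ω
    · have h1 := rsObservable_itoDrift_eq_zero κ (a := 0) (ψa := 1) (h := h) (hYpos s ω).ne'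
        (by rw [hhdef]; exact schrammH_ode (X s ω * (Y s ω)⁻¹))
      simp only [hD1def, hbwdef, hσwdef, hσBdef, hbXdef, haAdef, hwdef, hAdef, trunc_of_le hs]
      simpa using h1
    · simp only [hD1def, hbwdef, hσwdef, hσBdef, hbXdef, haAdef, trunc_of_not_le hs]
      ring
  have hw0 : ∀ ω, w 0 ω = z.re / z.im := fun ω ↦ by
    simp only [hwdef, hAdef, hXdef, hYdef]
    rw [stoppedProcess_slePointRe_zero hz, stoppedProcess_slePointIm_zero hz, div_eq_mul_inv]
  have hae : ∀ᵐ ω ∂preWienerMeasure, ∀ t : ℝ≥0, h (w t ω) = h (z.re / z.im) + Kw t ω := by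
    filter_upwards [hito] with ω hω t
    have h1 := hω t
    have h2 : (fun s : ℝ ↦ deriv (fun r : ℝ ↦ h (w s.toNNReal ω)) ((s.toNNReal : ℝ≥0) : ℝ) +
        bw s.toNNReal ω * deriv (fun v ↦ h v) (w s.toNNReal ω) +
        2⁻¹ * σw s.toNNReal ω ^ 2 * iteratedDeriv 2 (fun v ↦ h v) (w s.toNNReal ω)) =
        fun _ ↦ 0 := by
      funext s
      have := hdrift s.toNNReal ω
      simp only [hD1def] at this
      simp only [deriv_const, zero_add]
      exact this
    rw [h2, intervalIntegral.integral_zero, add_zero, hw0] at h1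
    exact h1
  have hmart : Martingale (fun t ω ↦ h (w t ω)) brownianFiltration preWienerMeasure := by
    have h1 : Martingale (fun t ω ↦ h (z.re / z.im) + Kw t ω) brownianFiltration preWienerMeasure :=
      (martingale_const brownianFiltration preWienerMeasure (h (z.re / z.im))).add hKwM
    refine h1.congr hGa fun t ↦ ?_
    filter_upwards [hae] with ω hω
    exact (hω t).symm
  ---------------------------------------------------------------------------
  -- Step 4: this is the stopped observable
  have heq : schrammObsStopped (fun s ω ↦ sleDriving κ ω s) z n = fun t ω ↦ h (w t ω) := by
    funext t ω
    have hT := coe_untopA_min_lt_swallowingTime hz hσρ t ω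
    show schrammObs (fun s ↦ sleDriving κ ω s) z ((min (t : WithTop ℝ≥0) (σ ω)).untopA) = h (w t ω)
    rw [show (fun s ↦ sleDriving κ ω s) = sleDriving κ ω from rfl,
      schrammObs_eq_schrammH (continuous_sleDriving κ ω) hz hT, ← hwcot]
  rw [heq]
  exact hmart

end Main

end Literature.Probability.RandomPlanarGeometry

end
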